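import Summits.QuantumFields.GaugeBoot.DiagonalRPTorusRestDictionary
import Literature.MathematicalPhysics.QuantumFieldTheory.UniformTorusClusteringProofs
import HarnessLib

/-!
# Uniform clustering of the rest measure on the torus (gauge-boot, L3 `d = 3` uniform window,
# brick 2b)

HONEST FRAMING (cell `pub-gaugeboot`, page 1 of every file): the venture produces certified bounds
on lattice expectations at stated coupling, gauge group, dimension and torus size; NOT a mass gap,
NOT a continuum limit, NOT a string tension; NOT Yang–Mills-summit-bearing (barriers
`FixedCouplingUltralocality`, `PerturbativeInvisibility`). This module is bookkeeping for the
structural NEGATIVE results on diagonal reflection positivity of tori; it discharges nothing by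
itself.

## Content (torus `(ℤ/L)^d`, compact metrisable `G`, continuous `ρ`, real `β`)

★★ **UNIFORM CLUSTERING OF THE REST** `abs_restTrunc_le`: the Literature's exponential clustering
for general plaquette systems at strong coupling (`PlaqSystem.norm_truncatedExpect_le` of
`PlaqSystemClustering`: replica formula, holomorphy in the coupling, Schwarz lemma with
multiplicity; constants INDEPENDENT of the label set) transported through the dictionary of
`DiagonalRPTorusRestDictionary`: for bounded measurable real observables `f`, `g` reading
disjoint link sets `E₁`, `E₂`, a finite set `V` of plaquettes switched on, `n` such that every
set `Q ⊆ V` of plaquettes JOINING `E₁` to `E₂` (`TJoins`: a plaquette of `Q` with a link in `E₁`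
is connected inside `Q`, through plaquettes sharing links, to one with a link in `E₂`) has at
least `n` plaquettes, and `0 ≤ β ≤ r < betaOne d ρ`:

  `|⟨fg⟩_V - ⟨f⟩_V ⟨g⟩_V| ≤ 2 C_f C_g κ^{(#E₁ + #E₂) 2^d d²} (β/r)^n`,  `κ = 2e^{1/2}`,

UNIFORMLY in `L` and in `V`. The combinatorial transfer (`touches_tlab_iff`, `adj_tlab_iff`,
`tjoins_of_joins`) identifies the torus system's bonds, adjacency and seeds with
`DiagRPUnif.plinks`, `padj`, `Touch` of `DiagonalRPTorusPlaquetteAdjacency`;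
`le_card_of_tjoins` is the level-function lower bound on the size of joining sets
(`Polymer.IsConn.le_card_sub_one`); `card_seedsOf_image_torusSect_le` bounds the seeds by
`#E · 2^d d²` uniformly in `L`.

Use (the `d = 3` leg of the uniform window; architecture note
`HOME/pub-gaugeboot-lean3/gen46/D3-UNIFORM-PLAN.md`): with a difference witness `A = O - O∘T` the
trick form is a signed sum of rest truncated correlations; the two DIAGONAL pairs sit at torus
distance `≍ L` and are bounded by the present file uniformly in `L`; the near pair carries the
sign. Elementary given the Literature layer (Osterwalder–Seiler, Ann. Phys. 110 (1978) 440, §3,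
Thm. 3.5; Seiler, LNP 159 (1982) Ch. 3); no named fact.
-/

open MeasureTheory Finset Function

namespace Summit.QuantumFields.GaugeBoot

open Literature.MathematicalPhysics.QuantumFieldTheory

noncomputable section

namespace DiagRPUnif

open DiagRPTube

variable {d L : ℕ} [NeZero L] {N : ℕ} {G : Type*} [Group G] [TopologicalSpace G]
  [IsTopologicalGroup G] [CompactSpace G] [MeasurableSpace G] [BorelSpace G]
  [SecondCountableTopology G] (ρ : G →* Matrix (Fin N) (Fin N) ℂ) (β : ℝ)

/-! ## Joining sets of plaquettes: the combinatorial transfer -/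

/-- `Q` JOINS the link sets `E₁` and `E₂`: a plaquette of `Q` with a link in `E₁` is connected
inside `Q`, through plaquettes sharing links, to a plaquette of `Q` with a link in `E₂`
(the torus form of `PlaqSystem.Joins`). -/
def TJoins (Q : Finset (Plaquette d L)) (E₁ E₂ : Finset (Edge d L)) : Prop :=
  ∃ p ∈ Q, ∃ q ∈ Q, Touch E₁ p ∧ Touch E₂ q ∧ Polymer.Reach padj Q p q

omit [TopologicalSpace G] [IsTopologicalGroup G] [CompactSpace G] [MeasurableSpace G]
  [BorelSpace G] [SecondCountableTopology G] in
/-- A label touches the sectioned link set iff the plaquette touches the link set. -/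
theorem touches_tlab_iff (E : Finset (Edge d L)) (q : Plaquette d L) :
    (torusSystem (G := G) ρ L).Touches (E.image (torusSect L)) (tlab q) ↔ Touch E q := by
  rw [PlaqSystem.Touches, torusSystem_bonds, tbonds_tlab,
    disjoint_image (torusSect_injective (L := L)), touch_iff, not_disjoint_iff]
  simp only [mem_plinks]
  exact ⟨fun ⟨e, hq, he⟩ => ⟨e, he, hq⟩, fun ⟨e, he, hq⟩ => ⟨e, hq, he⟩⟩

omit [TopologicalSpace G] [IsTopologicalGroup G] [CompactSpace G] [MeasurableSpace G]
  [BorelSpace G] [SecondCountableTopology G] in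
/-- Labels of genuine plaquettes are adjacent in the torus system iff the plaquettes share a
link. -/
theorem adj_tlab_iff (p q : Plaquette d L) :
    (torusSystem (G := G) ρ L).Adj (tlab p) (tlab q) ↔ padj p q := by
  rw [torusSystem_adj_iff, TPlaq.TAdj, tbonds_tlab, tbonds_tlab, padj_iff_not_disjoint]

omit [TopologicalSpace G] [IsTopologicalGroup G] [CompactSpace G] [MeasurableSpace G]
  [BorelSpace G] [SecondCountableTopology G] in
/-- **Transfer of joining**: a set of labels of plaquettes of `V` joining the sectioned link sets
in the torus system comes from a set of plaquettes of `V`, of the same size, joining the link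
sets. -/
theorem tjoins_of_joins {V : Finset (Plaquette d L)} {Q' : Finset (TPlaq d L)}
    (hQ' : Q' ⊆ V.image tlab) {E₁ E₂ : Finset (Edge d L)}
    (hJ : (torusSystem (G := G) ρ L).Joins Q' (E₁.image (torusSect L)) (E₂.image (torusSect L))) :
    ∃ Q ⊆ V, Q.card = Q'.card ∧ TJoins Q E₁ E₂ := by
  classical
  set Q : Finset (Plaquette d L) := V.filter fun q => tlab q ∈ Q' with hQ
  have hQimg : Q.image tlab = Q' := by
    ext x
    rw [mem_image]
    constructor
    · rintro ⟨q, hq, rfl⟩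
      exact (mem_filter.1 hq).2
    · intro hx
      obtain ⟨q, hqV, rfl⟩ := mem_image.1 (hQ' hx)
      exact ⟨q, mem_filter.2 ⟨hqV, hx⟩, rfl⟩
  have hmemQ : ∀ {q : Plaquette d L}, tlab q ∈ Q' → q ∈ Q := fun {q} hq => by
    obtain ⟨q₀, hq₀V, hq₀⟩ := mem_image.1 (hQ' hq)
    rw [tlab_injective hq₀] at hq₀V
    exact mem_filter.2 ⟨hq₀V, hq⟩
  refine ⟨Q, filter_subset _ _, ?_, ?_⟩
  · rw [← hQimg, card_image_of_injective _ tlab_injective]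
  obtain ⟨x, hx, y, hy, htx, hty, hreach⟩ := hJ
  obtain ⟨p, hpV, rfl⟩ := mem_image.1 (hQ' hx)
  obtain ⟨q, hqV, rfl⟩ := mem_image.1 (hQ' hy)
  refine ⟨p, hmemQ hx, q, hmemQ hy, (touches_tlab_iff ρ E₁ p).1 htx,
    (touches_tlab_iff ρ E₂ q).1 hty, ?_⟩
  -- transfer of the chain
  have key : ∀ z,
      Relation.ReflTransGen (Polymer.AdjIn (torusSystem (G := G) ρ L).Adj Q') (tlab p) z →
      ∃ q', z = tlab q' ∧ Polymer.Reach padj Q p q' := by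
    intro z hz
    induction hz with
    | refl => exact ⟨p, rfl, Polymer.Reach.refl p⟩
    | @tail b c _ hbc ih =>
      obtain ⟨b', rfl, hb'⟩ := ih
      obtain ⟨hbQ', hcQ', hadj⟩ := hbc
      obtain ⟨c', hc'V, rfl⟩ := mem_image.1 (hQ' hcQ')
      exact ⟨c', rfl, hb'.tail (hmemQ hbQ') (hmemQ hcQ') ((adj_tlab_iff ρ b' c').1 hadj)⟩
  obtain ⟨q', hq', hreach'⟩ := key _ hreach
  rwa [← tlab_injective hq'] at hreach'

omit [NeZero L] in
/-- **Joining sets are long** (level-function form): if `lv` grows by at most one between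
plaquettes sharing a link, is `≤ a` on the plaquettes touching `E₁` and `≥ b` on those touching
`E₂`, then every set of plaquettes joining `E₁` to `E₂` has at least `b - a` elements. -/
theorem le_card_of_tjoins (lv : Plaquette d L → ℕ) (hlv : ∀ u v, padj u v → lv v ≤ lv u + 1)
    {E₁ E₂ : Finset (Edge d L)} {a b : ℕ} (ha : ∀ p, Touch E₁ p → lv p ≤ a)
    (hb : ∀ q, Touch E₂ q → b ≤ lv q) {Q : Finset (Plaquette d L)} (hJ : TJoins Q E₁ E₂) :
    b - a ≤ Q.card := by
  classical
  obtain ⟨p, hp, q, hq, htp, htq, hreach⟩ := hJ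
  haveI : Std.Refl (padj : Plaquette d L → Plaquette d L → Prop) := ⟨padj_refl⟩
  haveI : Std.Symm (padj : Plaquette d L → Plaquette d L → Prop) := ⟨fun _ _ => padj_symm⟩
  have hX : Polymer.IsConn padj (Polymer.comp padj Q p) p := Polymer.isConn_comp hp
  have hqX : q ∈ Polymer.comp padj Q p := Polymer.mem_comp_of_reach hp hreach
  have h := hX.le_card_sub_one (fun u => lv u - lv p) (by simp)
    (fun u v huv => by have := hlv u v huv; omega) hqX
  have hcard : (Polymer.comp padj Q p).card ≤ Q.card := card_le_card (Polymer.comp_subset Q p)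
  have h1 := ha p htp
  have h2 := hb q htq
  omega

/-! ## Uniform clustering of the rest -/

omit [TopologicalSpace G] [IsTopologicalGroup G] [CompactSpace G] [MeasurableSpace G]
  [BorelSpace G] [SecondCountableTopology G] in
/-- The number of labels touching a sectioned link set is at most `#E · 2^d d²`, uniformly in
`L`. -/
theorem card_seedsOf_image_torusSect_le (E : Finset (Edge d L)) :
    ((torusSystem (G := G) ρ L).seedsOf (E.image (torusSect L))).card ≤
      E.card * (2 ^ d * (d * d)) := by
  have himg : E.image (torusSect L) = (E.image (torusSect L)).image (torusRed L) := by
    rw [image_image]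
    refine image_congr fun e _ => ?_
    simp [torusRed]
  rw [himg]
  refine (card_seedsOf_torusSystem_le ρ _).trans ((card_seedsOf_le_mul _).trans ?_)
  exact Nat.mul_le_mul_right _ card_image_le

omit [NeZero L] [Group G] [TopologicalSpace G] [IsTopologicalGroup G] [CompactSpace G]
  [MeasurableSpace G] [BorelSpace G] [SecondCountableTopology G] in
/-- An observable reading the torus links `E` reads, through the section, the bonds `σ(E)`. -/
theorem dependsOn_comp_torusSigma {α : Type*} {f : GaugeConfig d L G → α}
    {E : Finset (Edge d L)}
    (hf : DependsOn f (E : Set (Edge d L))) :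
    DependsOn (fun U : ZdGaugeConfig d G => f (torusSigma L U))
      ((E.image (torusSect L) : Finset (ZdEdge d)) : Set (ZdEdge d)) :=
  fun _ _ h => hf fun e he => h (torusSect L e) (mem_coe.2 (mem_image_of_mem _ (mem_coe.1 he)))

/-- ★★ **UNIFORM CLUSTERING OF THE REST.** Let `f`, `g` be bounded measurable real observables
reading disjoint link sets `E₁`, `E₂`, let every set of plaquettes of `V` joining `E₁` to `E₂`
have at least `n` elements, and let `0 ≤ β ≤ r < betaOne d ρ`. Then
`|⟨fg⟩_V - ⟨f⟩_V⟨g⟩_V| ≤ 2 C_f C_g κ^{(#E₁ + #E₂) 2^d d²} (β/r)^n` with `κ = 2e^{1/2}`: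
exponential clustering in the rest measure, with constants independent of `L` and of `V`. -/
theorem abs_restTrunc_le (hρ : Continuous ρ) (V : Finset (Plaquette d L))
    {f g : GaugeConfig d L G → ℝ} (hfm : Measurable f) (hgm : Measurable g) {Cf Cg : ℝ}
    (hfb : ∀ U, |f U| ≤ Cf) (hgb : ∀ U, |g U| ≤ Cg) {E₁ E₂ : Finset (Edge d L)}
    (hfE : DependsOn f (E₁ : Set (Edge d L))) (hgE : DependsOn g (E₂ : Set (Edge d L)))
    (hE : Disjoint E₁ E₂) {n : ℕ} (hn : ∀ Q ⊆ V, TJoins Q E₁ E₂ → n ≤ Q.card)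
    {r : ℝ} (hr : 0 < r) (hrR : r < betaOne d ρ) (hβ0 : 0 ≤ β) (hβr : β ≤ r) :
    |restTrunc ρ β V f g| ≤
      2 * Cf * Cg * (2 * Real.exp (1 / 2)) ^ ((E₁.card + E₂.card) * (2 ^ d * (d * d))) *
        (β / r) ^ n := by
  classical
  set S := torusSystem (G := G) ρ L with hS
  set Φ₁ : ZdGaugeConfig d G → ℂ := fun U => ((f (torusSigma L U) : ℝ) : ℂ) with hΦ₁
  set Φ₂ : ZdGaugeConfig d G → ℂ := fun U => ((g (torusSigma L U) : ℝ) : ℂ) with hΦ₂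
  set B₁ := E₁.image (torusSect L) with hB₁
  set B₂ := E₂.image (torusSect L) with hB₂
  set κ : ℝ := 2 * Real.exp (1 / 2) with hκ
  have hκ1 : 1 ≤ κ := by
    rw [hκ]; nlinarith [Real.add_one_le_exp (1 / 2 : ℝ)]
  have hCf : 0 ≤ Cf := (abs_nonneg _).trans (hfb 1)
  have hCg : 0 ≤ Cg := (abs_nonneg _).trans (hgb 1)
  have hΦ₁m : Measurable Φ₁ :=
    Complex.measurable_ofReal.comp (hfm.comp (measurable_torusSigma L))
  have hΦ₂m : Measurable Φ₂ :=
    Complex.measurable_ofReal.comp (hgm.comp (measurable_torusSigma L))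
  have hΦ₁b : ∀ U, ‖Φ₁ U‖ ≤ Cf := fun U => by
    rw [hΦ₁, Complex.norm_real, Real.norm_eq_abs]; exact hfb _
  have hΦ₂b : ∀ U, ‖Φ₂ U‖ ≤ Cg := fun U => by
    rw [hΦ₂, Complex.norm_real, Real.norm_eq_abs]; exact hgb _
  have hΦ₁d : DependsOn Φ₁ ((B₁ : Finset (ZdEdge d)) : Set (ZdEdge d)) :=
    dependsOn_comp_torusSigma (f := fun W => ((f W : ℝ) : ℂ)) fun U U' h => by
      show ((f U : ℝ) : ℂ) = f U'; rw [hfE h]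
  have hΦ₂d : DependsOn Φ₂ ((B₂ : Finset (ZdEdge d)) : Set (ZdEdge d)) :=
    dependsOn_comp_torusSigma (f := fun W => ((g W : ℝ) : ℂ)) fun U U' h => by
      show ((g U : ℝ) : ℂ) = g U'; rw [hgE h]
  have hB : Disjoint B₁ B₂ := by
    rw [hB₁, hB₂, disjoint_image (torusSect_injective (L := L))]; exact hE
  have hn' : ∀ Q', Q' ⊆ V.image tlab → S.Joins Q' B₁ B₂ → n ≤ Q'.card := by
    intro Q' hQ' hJ
    obtain ⟨Q, hQV, hcard, hTJ⟩ := tjoins_of_joins ρ hQ' hJ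
    rw [← hcard]
    exact hn Q hQV hTJ
  have hβ' : ‖(β : ℂ)‖ ≤ r := by
    rw [Complex.norm_real, Real.norm_eq_abs, abs_of_nonneg hβ0]; exact hβr
  have hrR' : r < PlaqSystem.betaR (costBound ρ) (Plaq.degBound d) := by
    rw [betaR_costBound]; exact hrR
  have hmain := PlaqSystem.norm_truncatedExpect_le (torusSystem_regular ρ hρ (L := L)) hΦ₁m hΦ₂m
    hΦ₁b hΦ₂b hΦ₁d hΦ₂d hB (V.image tlab) hn' hr hrR' hβ'
  have hnβ : ‖(β : ℂ)‖ = β := by rw [Complex.norm_real, Real.norm_eq_abs, abs_of_nonneg hβ0]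
  rw [hnβ] at hmain
  -- the real truncated correlation is the complex one
  have hre : |restTrunc ρ β V f g| ≤
      ‖S.expect (fun U => Φ₁ U * Φ₂ U) (V.image tlab) β -
        S.expect Φ₁ (V.image tlab) β * S.expect Φ₂ (V.image tlab) β‖ := by
    rw [← Real.norm_eq_abs, ← Complex.norm_real, ofReal_restTrunc_eq ρ β hρ V hfm hgm]
  refine hre.trans (hmain.trans ?_)
  -- seed counts, uniformly in `L`
  have hs₁ : (S.seedsOf B₁).card ≤ E₁.card * (2 ^ d * (d * d)) :=
    card_seedsOf_image_torusSect_le ρ E₁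
  have hs₂ : (S.seedsOf B₂).card ≤ E₂.card * (2 ^ d * (d * d)) :=
    card_seedsOf_image_torusSect_le ρ E₂
  have hs₁₂ : (S.seedsOf (B₁ ∪ B₂)).card ≤ (E₁.card + E₂.card) * (2 ^ d * (d * d)) := by
    rw [hB₁, hB₂, ← image_union]
    refine (card_seedsOf_image_torusSect_le ρ _).trans ?_
    exact Nat.mul_le_mul_right _ (card_union_le _ _)
  have hpow : 0 ≤ (β / r) ^ n := pow_nonneg (div_nonneg hβ0 hr.le) n
  set s := (E₁.card + E₂.card) * (2 ^ d * (d * d)) with hs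
  have e1 : κ ^ (S.seedsOf (B₁ ∪ B₂)).card ≤ κ ^ s := pow_le_pow_right₀ hκ1 hs₁₂
  have e2 : κ ^ (S.seedsOf B₁).card * κ ^ (S.seedsOf B₂).card ≤ κ ^ s := by
    rw [← pow_add]
    refine pow_le_pow_right₀ hκ1 ?_
    rw [hs, add_mul]
    exact add_le_add hs₁ hs₂
  have hK : Cf * Cg * κ ^ (S.seedsOf (B₁ ∪ B₂)).card +
      Cf * κ ^ (S.seedsOf B₁).card * (Cg * κ ^ (S.seedsOf B₂).card) ≤ 2 * Cf * Cg * κ ^ s := by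
    have h2 : Cf * κ ^ (S.seedsOf B₁).card * (Cg * κ ^ (S.seedsOf B₂).card) =
        Cf * Cg * (κ ^ (S.seedsOf B₁).card * κ ^ (S.seedsOf B₂).card) := by ring
    rw [h2]
    have hCC : 0 ≤ Cf * Cg := mul_nonneg hCf hCg
    nlinarith [mul_le_mul_of_nonneg_left e1 hCC, mul_le_mul_of_nonneg_left e2 hCC]
  exact mul_le_mul_of_nonneg_right hK hpow

end DiagRPUnif

end

end Summit.QuantumFields.GaugeBoot
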